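import Summits.Ventures.Crystal3D.Theorems.StickyWulffConstantStackingLiminfChimeraStackWulff

/-!
# Chimera Brunn–Minkowski with a summand depending on height AND abscissa under FIBRE-LENGTH
# domination (engine for the zone rung of `PolycrystalWulffBound`, line `PolyDensity`,
# crux `stmt-Ventures-19482`)

Route `StickyWulffConstant` of the venture `Summits/Ventures/Crystal3D`, second prover lane (poly-p2,
gen 8).  The SL line's `Chimera.chimera3_volume_rpow_mul_le` (height-dependent summand `W t` whose
horizontal SECTIONS dominate those of a reference body, in AREA) is Prékopa–Leindler on the line over
the planar multiplicative Brunn–Minkowski inequality.  Running the same argument one level deeper —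
Prékopa–Leindler on the line over Prékopa–Leindler on the line over the one-dimensional multiplicative
Brunn–Minkowski inequality — lets the summand depend on the height `a₂` AND the abscissa `a₀` of the
point `a`, provided the bodies' one-dimensional FIBRES `{y | (η, y, u) ∈ W t x}` dominate those of the
reference body IN LENGTH:
* `volume_rpow_mul_volume_rpow_le_real1` — multiplicative Brunn–Minkowski on `ℝ` (PL for indicators);
* `chimera2_fibre_volume_rpow_mul_le` — planar chimera (`ℝ × ℝ`, summand indexed by the abscissa);
* `chimera3_fibre_volume_rpow_mul_le` / `chimera3_fibre_brunnMinkowski_pow` /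
  `chimera3_fibre_brunnMinkowski` — `Fin 3 → ℝ`, summand `W t x`, conclusion
  `|A|^{1/3} + |W₀|^{1/3} ≤ |C|^{1/3}` for `C ⊇ {a + w | a ∈ A, w ∈ W (a 2) (a 0)}`.
Used by `…ZoneChimera` / `…RungZone`: twin textures whose walls all contain one horizontal direction
(the fibre direction) have bodies `B₀`, `R_m B₀` with equal fibre lengths when `B₀` has a mirror
containing the axis and the fibre.
WHAT THIS IS NOT: anything about lattices or perimeters; no Knothe map; the crux is not claimed.
-/

noncomputable section

namespace Summit.Ventures.Crystal3D.Theorems.Chimera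

open MeasureTheory Set
open Literature.Analysis.Convexity (prekopaLeindler_real)
open scoped ENNReal Pointwise

/-! ### One-dimensional multiplicative Brunn–Minkowski -/

/-- **Multiplicative Brunn–Minkowski on the line**: `(1−s)A + sB ⊆ C ⇒ |A|^{1−s}|B|^s ≤ |C|`
(Prékopa–Leindler for the indicators). -/
theorem volume_rpow_mul_volume_rpow_le_real1 {s : ℝ} (hs0 : 0 < s) (hs1 : s < 1)
    {A B C : Set ℝ} (hA : MeasurableSet A) (hB : MeasurableSet B) (hC : MeasurableSet C)
    (hsub : (1 - s) • A + s • B ⊆ C) :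
    volume A ^ (1 - s) * volume B ^ s ≤ volume C := by
  have key := prekopaLeindler_real hs0 hs1 (f := A.indicator 1) (g := B.indicator 1)
    (h := C.indicator 1) (measurable_one.indicator hA) (measurable_one.indicator hB)
    (measurable_one.indicator hC) ?_
  · rwa [lintegral_indicator_one hA, lintegral_indicator_one hB, lintegral_indicator_one hC] at key
  · intro x y
    by_cases hx : x ∈ A
    · by_cases hy : y ∈ B
      · have hz : (1 - s) * x + s * y ∈ C := by
          simpa [smul_eq_mul] using
            hsub (Set.add_mem_add (Set.smul_mem_smul_set hx) (Set.smul_mem_smul_set hy))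
        simp [Set.indicator_of_mem, hx, hy, hz]
      · simp [Set.indicator_of_notMem, hy, ENNReal.zero_rpow_of_pos hs0]
    · simp [Set.indicator_of_notMem, hx, ENNReal.zero_rpow_of_pos (sub_pos.2 hs1)]

/-- Length of a dilated set on the line: `|r • S| = |r|·|S|`. -/
theorem volume_smul_real1 (r : ℝ) (S : Set ℝ) :
    volume (r • S) = ENNReal.ofReal |r| * volume S := by
  rw [Measure.addHaar_smul, Module.finrank_self, pow_one]

/-! ### Fibres of planar sets -/

/-- The planar measure is the integral of the fibre lengths. -/
theorem volume_eq_lintegral_fibre2 (S : Set (ℝ × ℝ)) (hS : MeasurableSet S) :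
    volume S = ∫⁻ ξ : ℝ, volume (Prod.mk ξ ⁻¹' S) := by
  rw [Measure.volume_eq_prod, Measure.prod_apply hS]

/-- The fibre-length function of a measurable planar set is measurable. -/
theorem measurable_volume_fibre2 {S : Set (ℝ × ℝ)} (hS : MeasurableSet S) :
    Measurable fun ξ : ℝ => volume (Prod.mk ξ ⁻¹' S) :=
  measurable_measure_prodMk_left hS

/-! ### Planar chimera Brunn–Minkowski with abscissa-dependent summand -/

/-- **Planar chimera Brunn–Minkowski, multiplicative form** (`ℝ × ℝ`, abscissa = first coordinate):
if the fibres of the abscissa-indexed bodies `K x` dominate those of `K₀` IN LENGTH and `C` contains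
every `(1−s)p + s q`, `p ∈ A`, `q ∈ K(p.1)`, then `|A|^{1−s}|K₀|^s ≤ |C|`. -/
theorem chimera2_fibre_volume_rpow_mul_le {s : ℝ} (hs0 : 0 < s) (hs1 : s < 1)
    {A C K₀ : Set (ℝ × ℝ)} (K : ℝ → Set (ℝ × ℝ))
    (hA : MeasurableSet A) (hC : MeasurableSet C) (hK₀ : MeasurableSet K₀)
    (hK : ∀ x, MeasurableSet (K x))
    (hdom : ∀ x η, volume (Prod.mk η ⁻¹' K₀) ≤ volume (Prod.mk η ⁻¹' K x))
    (hsub : ∀ p ∈ A, ∀ q ∈ K p.1, (1 - s) • p + s • q ∈ C) :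
    volume A ^ (1 - s) * volume K₀ ^ s ≤ volume C := by
  set φ : ℝ → ℝ≥0∞ := fun ξ => volume (Prod.mk ξ ⁻¹' A) with hφ
  set ψ : ℝ → ℝ≥0∞ := fun η => volume (Prod.mk η ⁻¹' K₀) with hψ
  set h : ℝ → ℝ≥0∞ := fun ζ => volume (Prod.mk ζ ⁻¹' C) with hh
  have key : ∀ ξ η, φ ξ ^ (1 - s) * ψ η ^ s ≤ h ((1 - s) • ξ + s • η) := by
    intro ξ η
    have hincl : (1 - s) • (Prod.mk ξ ⁻¹' A) + s • (Prod.mk η ⁻¹' K ξ) ⊆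
        Prod.mk ((1 - s) • ξ + s • η) ⁻¹' C := by
      intro y hy
      obtain ⟨_, ⟨y₁, hy₁, rfl⟩, _, ⟨y₂, hy₂, rfl⟩, rfl⟩ := hy
      have h1 := hsub (ξ, y₁) hy₁ (η, y₂) hy₂
      simpa [Prod.smul_mk, smul_eq_mul] using h1
    calc φ ξ ^ (1 - s) * ψ η ^ s ≤ volume (Prod.mk ξ ⁻¹' A) ^ (1 - s) * volume (Prod.mk η ⁻¹' K ξ) ^ s := by
          gcongr
          exact hdom ξ η
      _ ≤ h ((1 - s) • ξ + s • η) :=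
          volume_rpow_mul_volume_rpow_le_real1 hs0 hs1 (hA.preimage measurable_prodMk_left)
            ((hK ξ).preimage measurable_prodMk_left) (hC.preimage measurable_prodMk_left) hincl
  have pl := prekopaLeindler_real hs0 hs1 (measurable_volume_fibre2 hA) (measurable_volume_fibre2 hK₀)
    (measurable_volume_fibre2 hC) key
  rw [volume_eq_lintegral_fibre2 A hA, volume_eq_lintegral_fibre2 K₀ hK₀, volume_eq_lintegral_fibre2 C hC]
  exact pl

/-! ### Fibres of sets in `Fin 3 → ℝ` -/

/-- The fibre of the horizontal section `{p | (p.1,p.2,u) ∈ S}` over the abscissa `η` is the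
vertical-coordinate fibre `{y | (η, y, u) ∈ S}`. -/
theorem fibre_slice3 (S : Set (Fin 3 → ℝ)) (u η : ℝ) :
    Prod.mk η ⁻¹' {p : ℝ × ℝ | (![p.1, p.2, u] : Fin 3 → ℝ) ∈ S} =
      {y : ℝ | (![η, y, u] : Fin 3 → ℝ) ∈ S} := by
  ext y; simp

/-- Fibres of a dilate: `{y | (η,y,u) ∈ r • S} = r • {y | (r⁻¹η, y, r⁻¹u) ∈ S}` (`r ≠ 0`). -/
theorem fibre3_smul {r : ℝ} (hr : r ≠ 0) (S : Set (Fin 3 → ℝ)) (u η : ℝ) :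
    {y : ℝ | (![η, y, u] : Fin 3 → ℝ) ∈ r • S} =
      r • {y : ℝ | (![r⁻¹ * η, y, r⁻¹ * u] : Fin 3 → ℝ) ∈ S} := by
  ext y
  rw [mem_setOf_eq, Set.mem_smul_set_iff_inv_smul_mem₀ hr, Set.mem_smul_set_iff_inv_smul_mem₀ hr,
    mem_setOf_eq]
  have : r⁻¹ • (![η, y, u] : Fin 3 → ℝ) = ![r⁻¹ * η, r⁻¹ • y, r⁻¹ * u] := by
    ext i; fin_cases i <;> simp [smul_eq_mul]
  rw [this]

/-! ### Chimera Brunn–Minkowski in `Fin 3 → ℝ` with height-and-abscissa-dependent summand -/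

/-- **Fibre chimera Brunn–Minkowski, multiplicative form** (`Fin 3 → ℝ`; height = coordinate `2`,
abscissa = coordinate `0`, fibre = coordinate `1`): if the fibres of the bodies `W t x` dominate those
of `W₀` in length and `C` contains every `(1−s)a + s w`, `a ∈ A`, `w ∈ W (a 2) (a 0)`, then
`|A|^{1−s}|W₀|^s ≤ |C|`. -/
theorem chimera3_fibre_volume_rpow_mul_le {s : ℝ} (hs0 : 0 < s) (hs1 : s < 1)
    {A C W₀ : Set (Fin 3 → ℝ)} (W : ℝ → ℝ → Set (Fin 3 → ℝ))
    (hA : MeasurableSet A) (hC : MeasurableSet C) (hW₀ : MeasurableSet W₀)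
    (hW : ∀ t x, MeasurableSet (W t x))
    (hdom : ∀ t x u η, volume {y : ℝ | (![η, y, u] : Fin 3 → ℝ) ∈ W₀} ≤
      volume {y : ℝ | (![η, y, u] : Fin 3 → ℝ) ∈ W t x})
    (hsub : ∀ a ∈ A, ∀ w ∈ W (a 2) (a 0), (1 - s) • a + s • w ∈ C) :
    volume A ^ (1 - s) * volume W₀ ^ s ≤ volume C := by
  set φ : ℝ → ℝ≥0∞ := fun t => volume {p : ℝ × ℝ | (![p.1, p.2, t] : Fin 3 → ℝ) ∈ A} with hφ
  set ψ : ℝ → ℝ≥0∞ := fun u => volume {p : ℝ × ℝ | (![p.1, p.2, u] : Fin 3 → ℝ) ∈ W₀} with hψ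
  set h : ℝ → ℝ≥0∞ := fun z => volume {p : ℝ × ℝ | (![p.1, p.2, z] : Fin 3 → ℝ) ∈ C} with hh
  have key : ∀ t u, φ t ^ (1 - s) * ψ u ^ s ≤ h ((1 - s) • t + s • u) := by
    intro t u
    -- the planar fibre chimera in the sections at heights `t` (of `A`) and `u` (of the bodies)
    have h2 := chimera2_fibre_volume_rpow_mul_le hs0 hs1
      (A := {p : ℝ × ℝ | (![p.1, p.2, t] : Fin 3 → ℝ) ∈ A})
      (C := {p : ℝ × ℝ | (![p.1, p.2, (1 - s) • t + s • u] : Fin 3 → ℝ) ∈ C})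
      (K₀ := {p : ℝ × ℝ | (![p.1, p.2, u] : Fin 3 → ℝ) ∈ W₀})
      (fun x => {p : ℝ × ℝ | (![p.1, p.2, u] : Fin 3 → ℝ) ∈ W t x})
      (measurableSet_slice3 hA t) (measurableSet_slice3 hC _) (measurableSet_slice3 hW₀ u)
      (fun x => measurableSet_slice3 (hW t x) u)
      (by
        intro x η
        rw [fibre_slice3, fibre_slice3]
        exact hdom t x u η)
      (by
        rintro p hp q hq
        have hq' : (![q.1, q.2, u] : Fin 3 → ℝ) ∈ W ((![p.1, p.2, t] : Fin 3 → ℝ) 2)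
            ((![p.1, p.2, t] : Fin 3 → ℝ) 0) := by simpa using hq
        have h1 := hsub _ hp _ hq'
        have e : (1 - s) • (![p.1, p.2, t] : Fin 3 → ℝ) + s • (![q.1, q.2, u] : Fin 3 → ℝ) =
            ![((1 - s) • p + s • q).1, ((1 - s) • p + s • q).2, (1 - s) • t + s • u] := by
          ext i; fin_cases i <;> simp [smul_eq_mul]
        rw [e] at h1
        exact h1)
    exact h2
  have pl := prekopaLeindler_real hs0 hs1 (measurable_volume_slice3 hA)
    (measurable_volume_slice3 hW₀) (measurable_volume_slice3 hC) key
  rw [volume_eq_lintegral_slice3 A hA, volume_eq_lintegral_slice3 W₀ hW₀, volume_eq_lintegral_slice3 C hC]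
  exact pl

/-- **Fibre chimera Brunn–Minkowski, additive (homogeneous) form**: with
`C ⊇ {a + w | a ∈ A, w ∈ W (a 2) (a 0)}`, `a³ ≤ |A|`, `b³ ≤ |W₀|` (`a, b > 0`): `(a + b)³ ≤ |C|`. -/
theorem chimera3_fibre_brunnMinkowski_pow
    {A C W₀ : Set (Fin 3 → ℝ)} (W : ℝ → ℝ → Set (Fin 3 → ℝ))
    (hA : MeasurableSet A) (hC : MeasurableSet C) (hW₀ : MeasurableSet W₀)
    (hW : ∀ t x, MeasurableSet (W t x))
    (hdom : ∀ t x u η, volume {y : ℝ | (![η, y, u] : Fin 3 → ℝ) ∈ W₀} ≤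
      volume {y : ℝ | (![η, y, u] : Fin 3 → ℝ) ∈ W t x})
    (hsub : ∀ a ∈ A, ∀ w ∈ W (a 2) (a 0), a + w ∈ C)
    {a b : ℝ} (ha : 0 < a) (hb : 0 < b) (hvA : ENNReal.ofReal (a ^ 3) ≤ volume A)
    (hvB : ENNReal.ofReal (b ^ 3) ≤ volume W₀) :
    ENNReal.ofReal ((a + b) ^ 3) ≤ volume C := by
  have hab : 0 < a + b := add_pos ha hb
  set s : ℝ := b / (a + b) with hs
  have hs0 : 0 < s := div_pos hb hab
  have hs1 : s < 1 := (div_lt_one hab).2 (by linarith)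
  have h1s : 1 - s = a / (a + b) := by rw [hs]; field_simp; ring
  have hvA' : 1 ≤ volume (a⁻¹ • A) := by
    rw [volume_smul_fin3, abs_of_pos (inv_pos.2 ha)]
    calc (1 : ℝ≥0∞) = ENNReal.ofReal (a⁻¹ ^ 3) * ENNReal.ofReal (a ^ 3) := by
          rw [← ENNReal.ofReal_mul (pow_nonneg (inv_pos.2 ha).le _), ← mul_pow,
            inv_mul_cancel₀ ha.ne', one_pow, ENNReal.ofReal_one]
      _ ≤ ENNReal.ofReal (a⁻¹ ^ 3) * volume A := by gcongr
  have hvB' : 1 ≤ volume (b⁻¹ • W₀) := by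
    rw [volume_smul_fin3, abs_of_pos (inv_pos.2 hb)]
    calc (1 : ℝ≥0∞) = ENNReal.ofReal (b⁻¹ ^ 3) * ENNReal.ofReal (b ^ 3) := by
          rw [← ENNReal.ofReal_mul (pow_nonneg (inv_pos.2 hb).le _), ← mul_pow,
            inv_mul_cancel₀ hb.ne', one_pow, ENNReal.ofReal_one]
      _ ≤ ENNReal.ofReal (b⁻¹ ^ 3) * volume W₀ := by gcongr
  have hdom' : ∀ t x u η, volume {y : ℝ | (![η, y, u] : Fin 3 → ℝ) ∈ b⁻¹ • W₀} ≤
      volume {y : ℝ | (![η, y, u] : Fin 3 → ℝ) ∈ b⁻¹ • W (a * t) (a * x)} := by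
    intro t x u η
    rw [fibre3_smul (inv_ne_zero hb.ne'), fibre3_smul (inv_ne_zero hb.ne'), volume_smul_real1,
      volume_smul_real1]
    exact mul_le_mul' le_rfl (hdom _ _ _ _)
  have hsub' : ∀ a' ∈ a⁻¹ • A, ∀ w' ∈ (fun t x => b⁻¹ • W (a * t) (a * x)) (a' 2) (a' 0),
      (1 - s) • a' + s • w' ∈ (a + b)⁻¹ • C := by
    intro a' ha' w' hw'
    obtain ⟨x, hx, rfl⟩ := Set.mem_smul_set.1 ha'
    obtain ⟨y, hy, rfl⟩ := Set.mem_smul_set.1 hw'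
    have hxy : x + y ∈ C := by
      refine hsub x hx y ?_
      have e2 : a * (a⁻¹ • x) 2 = x 2 := by
        rw [Pi.smul_apply, smul_eq_mul, ← mul_assoc, mul_inv_cancel₀ ha.ne', one_mul]
      have e0 : a * (a⁻¹ • x) 0 = x 0 := by
        rw [Pi.smul_apply, smul_eq_mul, ← mul_assoc, mul_inv_cancel₀ ha.ne', one_mul]
      simp only [e2, e0] at hy
      exact hy
    refine Set.mem_smul_set.2 ⟨x + y, hxy, ?_⟩
    rw [h1s, hs, smul_smul, smul_smul, div_mul_eq_mul_div, mul_inv_cancel₀ ha.ne',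
      div_mul_eq_mul_div, mul_inv_cancel₀ hb.ne', one_div, smul_add]
  have hmult := chimera3_fibre_volume_rpow_mul_le hs0 hs1 (fun t x => b⁻¹ • W (a * t) (a * x))
    (hA.const_smul₀ a⁻¹) (hC.const_smul₀ (a + b)⁻¹) (hW₀.const_smul₀ b⁻¹)
    (fun t x => (hW (a * t) (a * x)).const_smul₀ b⁻¹) hdom' hsub'
  have hone : (1 : ℝ≥0∞) ≤ volume ((a + b)⁻¹ • C) := by
    calc (1 : ℝ≥0∞) = 1 ^ (1 - s) * 1 ^ s := by rw [ENNReal.one_rpow, ENNReal.one_rpow, one_mul]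
      _ ≤ volume (a⁻¹ • A) ^ (1 - s) * volume (b⁻¹ • W₀) ^ s :=
          mul_le_mul' (ENNReal.rpow_le_rpow hvA' (by linarith)) (ENNReal.rpow_le_rpow hvB' hs0.le)
      _ ≤ volume ((a + b)⁻¹ • C) := hmult
  rw [volume_smul_fin3, abs_of_pos (inv_pos.2 hab)] at hone
  calc ENNReal.ofReal ((a + b) ^ 3) = ENNReal.ofReal ((a + b) ^ 3) * 1 := (mul_one _).symm
    _ ≤ ENNReal.ofReal ((a + b) ^ 3) * (ENNReal.ofReal ((a + b)⁻¹ ^ 3) * volume C) := by gcongr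
    _ = volume C := by
        rw [← mul_assoc, ← ENNReal.ofReal_mul (pow_nonneg hab.le _), ← mul_pow,
          mul_inv_cancel₀ hab.ne', one_pow, ENNReal.ofReal_one, one_mul]

/-- **Fibre chimera Brunn–Minkowski, root form**: `|A|^{1/3} + |W₀|^{1/3} ≤ |C|^{1/3}` for
`0 < |A| < ∞`, `0 < |W₀| < ∞`, when the fibres of the bodies `W t x` dominate those of `W₀` in length
and `C ⊇ {a + w | a ∈ A, w ∈ W (a 2) (a 0)}`. -/
theorem chimera3_fibre_brunnMinkowski
    {A C W₀ : Set (Fin 3 → ℝ)} (W : ℝ → ℝ → Set (Fin 3 → ℝ))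
    (hA : MeasurableSet A) (hC : MeasurableSet C) (hW₀ : MeasurableSet W₀)
    (hW : ∀ t x, MeasurableSet (W t x))
    (hdom : ∀ t x u η, volume {y : ℝ | (![η, y, u] : Fin 3 → ℝ) ∈ W₀} ≤
      volume {y : ℝ | (![η, y, u] : Fin 3 → ℝ) ∈ W t x})
    (hsub : ∀ a ∈ A, ∀ w ∈ W (a 2) (a 0), a + w ∈ C)
    (hA0 : volume A ≠ 0) (hAt : volume A ≠ ⊤) (hB0 : volume W₀ ≠ 0) (hBt : volume W₀ ≠ ⊤) :
    volume A ^ ((3 : ℕ)⁻¹ : ℝ) + volume W₀ ^ ((3 : ℕ)⁻¹ : ℝ) ≤ volume C ^ ((3 : ℕ)⁻¹ : ℝ) := by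
  have hn : (3 : ℕ) ≠ 0 := by norm_num
  have hn0 : (0 : ℝ) < ((3 : ℕ)⁻¹ : ℝ) := by positivity
  set a : ℝ := (volume A).toReal ^ ((3 : ℕ)⁻¹ : ℝ) with ha_def
  set b : ℝ := (volume W₀).toReal ^ ((3 : ℕ)⁻¹ : ℝ) with hb_def
  have ha : 0 < a := Real.rpow_pos_of_pos (ENNReal.toReal_pos hA0 hAt) _
  have hb : 0 < b := Real.rpow_pos_of_pos (ENNReal.toReal_pos hB0 hBt) _
  have han : ENNReal.ofReal (a ^ 3) = volume A := by
    rw [ha_def, Real.rpow_inv_natCast_pow ENNReal.toReal_nonneg hn, ENNReal.ofReal_toReal hAt]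
  have hbn : ENNReal.ofReal (b ^ 3) = volume W₀ := by
    rw [hb_def, Real.rpow_inv_natCast_pow ENNReal.toReal_nonneg hn, ENNReal.ofReal_toReal hBt]
  have hpow := chimera3_fibre_brunnMinkowski_pow W hA hC hW₀ hW hdom hsub ha hb han.le hbn.le
  have hroot := ENNReal.rpow_le_rpow hpow hn0.le
  rw [ENNReal.ofReal_rpow_of_nonneg (pow_nonneg (add_nonneg ha.le hb.le) _) hn0.le,
    Real.pow_rpow_inv_natCast (add_nonneg ha.le hb.le) hn, ENNReal.ofReal_add ha.le hb.le] at hroot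
  have hA' : ENNReal.ofReal a = volume A ^ ((3 : ℕ)⁻¹ : ℝ) := by
    rw [ha_def, ← ENNReal.ofReal_rpow_of_nonneg ENNReal.toReal_nonneg hn0.le,
      ENNReal.ofReal_toReal hAt]
  have hB' : ENNReal.ofReal b = volume W₀ ^ ((3 : ℕ)⁻¹ : ℝ) := by
    rw [hb_def, ← ENNReal.ofReal_rpow_of_nonneg ENNReal.toReal_nonneg hn0.le,
      ENNReal.ofReal_toReal hBt]
  rwa [hA', hB'] at hroot

end Summit.Ventures.Crystal3D.Theorems.Chimera

end
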